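import Summits.Ventures.LatticeQCDFlow.Scaling.SwapLadderIndexTauIntOptimumShape

/-!
HONEST FRAMING: exact (Metropolis-corrected) sampling algorithms for lattice gauge theory; figures
of merit are autocorrelation/cost numbers at stated couplings and volumes; no continuum-physics
claim.

# SwapLadderIndexTauIntCritGap — THE CRITICAL GAP `critGap R` (`G′(critGap R) = R·G′(0)`) AND THE CRITICAL TOTAL
# STIFFNESS `Λ_c(K) = Σ_{j<K} critGap((w_max/w_j)²)` OF THE `τ_int`-OPTIMAL SWAP LADDER (row 22 `su3-ptbc`, GEN-8,
# ours; part 1 of 3 of the collapse-threshold packet — `SwapLadderIndexTauIntClosedSimplex`, `SwapLadderIndexTauIntThreshold`)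

Venture `LatticeQCDFlow` (cell pub-lqcd), topic `Scaling`; FANOUT row 22 (`su3-ptbc`).  NEW WORK of the cell over
GEN-7's `SwapLadderIndexTauIntOptimumShape` (`passageWeight_pos`, `passageWeight_zero_lt`, `passageWeight_symm`,
`deriv_gaussInvAcc_pos`, `deriv_gaussInvAcc_zero`), GEN-6's `SwapLadderRoundTripOptimum` (`G = gaussInvAcc =
1/erfc(·/(2√2))`, `deriv_gaussInvAcc = G·(−(log gaussAcc)′)`, `strictMono_deriv_gaussInvAcc`,
`strictMono_gaussNegLogDeriv`), `SwapLadderLogConcave` (`erfc_lt_inv_mul`, `hasDerivAt_erfcLogDeriv`) and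
`SwapLadderIndexPoisson` (`passageWeight K j = (j+1)(K−j)`).  Mathlib otherwise (`intermediate_value_Icc`,
`IsClosed.csInf_mem`).  Nothing is cited as a fact; no `native_decide`.

THE POINT (model statements).  At a positive minimiser of the replica-index cost `Σ_j w_j²·G(ℓ_j)` at fixed total
stiffness, `w_j²·G′(ℓ_j)` is the same for all `j` (`SwapLadderIndexTauIntOptimumShape.stationary_of_isMinOn`), and
the common value exceeds `w_max²·G′(0)`; so gap `j` must exceed the stiffness at which `G′` reaches
`(w_max/w_j)²·G′(0)`.  This file names and controls that stiffness:

* §1 `G′` is continuous (`continuous_deriv_gaussInvAcc`) and **`G′(ℓ) > ℓ/4` for `ℓ > 0`**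
  (`div_four_lt_deriv_gaussInvAcc`: Mills ratio `1/erfc x > x√π` and `−(log gaussAcc)′(ℓ) ≥ −(log gaussAcc)′(0)`), so
  for every ratio `R` there is a least stiffness **`critGap R ≥ 0` with `G′(critGap R) ≥ R·G′(0)`** (an attained
  infimum); for `R ≥ 1`: **`G′(critGap R) = R·G′(0)`** (`deriv_critGap_eq`, intermediate values) and
  **`G′(c) ≤ R·G′(0) ↔ c ≤ critGap R`** (`deriv_le_iff_le_critGap`; strict form `lt_deriv_iff_critGap_lt`);
  `critGap R = 0` for `R ≤ 1`, `> 0` for `R > 1`; monotone in `R`; `critGap R < 4R·G′(0)`.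
* §2 the largest passage weight **`maxPassageWeight K = w_{⌊(K−1)/2⌋} ≥ w_j`** (`passageWeight_le_max`:
  `(m+1)(K−m) − (j+1)(K−j) = (m−j)(K−1−m−j) ≥ 0`), and the **critical stiffness
  `thresholdStiffness K = Σ_{j<K} critGap((w_max/w_j)²)`**: `≥ 0`; `= 0` for `K ≤ 2` (equal weights); `> 0` for
  `K ≥ 3` (`w_0 = K < w_1`); `2·critGap((w_max/K)²) ≤ Λ_c(K) ≤ K·critGap((w_max/K)²)`.

The sequels prove: a positive index-optimal gap vector of total stiffness `Λ` EXISTS iff `Λ > Λ_c(K)`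
(`SwapLadderIndexTauIntThreshold.exists_isMinOn_gapSimplex_iff`).  NOT CLAIMED: a closed form or the large-`K`
asymptotics of `Λ_c(K)` (desk numerics of GEN-7, not certified: `Λ_c ≈ 1.39, 4.07, 7.65, 10.92, 15.65` at
`K = 3, 6, 9, 12, 16`, against `Λ ≈ 2.56·K` for the card's flat-`20 %` ladders); anything about PTBC itself or a run.
-/

noncomputable section

open Finset Real Filter Topology
open Literature.ComputerArithmetic.BrentZimmermann2010.AsymptoticExpansions (erfc erfc_pos)

namespace Summit.Ventures.LatticeQCDFlow.Scaling

/-! ## §1 `G′` is continuous and unbounded; the critical gap `critGap R` -/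

section CritGap

/-- `G′ = gaussInvAcc′` is continuous. [ours] -/
theorem continuous_deriv_gaussInvAcc : Continuous (deriv gaussInvAcc) := by
  have h1 : Continuous erfcLogDeriv :=
    continuous_iff_continuousAt.2 fun x => (hasDerivAt_erfcLogDeriv x).continuousAt
  have h2 : Continuous gaussNegLogDeriv := by
    unfold gaussNegLogDeriv
    fun_prop
  rw [deriv_gaussInvAcc]
  exact continuous_gaussInvAcc.mul h2

/-- `−(log gaussAcc)′(0) = G′(0) = (2/√π)·(1/(2√2))` (`G(0) = 1`). [ours] -/
theorem gaussNegLogDeriv_zero : gaussNegLogDeriv 0 = 2 / sqrt π * (1 / (2 * sqrt 2)) := by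
  have h := deriv_gaussInvAcc_zero
  rw [deriv_gaussInvAcc] at h
  simpa [gaussInvAcc_apply, gaussAcc_zero] using h

/-- **`G′(ℓ) > ℓ/4` for `ℓ > 0`**: `G(ℓ) = 1/erfc(x) > x√π` (`x = ℓ/(2√2)`, Mills ratio) and
`−(log gaussAcc)′(ℓ) ≥ −(log gaussAcc)′(0) = 1/(√π·√2)`.  In particular `G′` is unbounded. [ours] -/
theorem div_four_lt_deriv_gaussInvAcc {ℓ : ℝ} (hℓ : 0 < ℓ) : ℓ / 4 < deriv gaussInvAcc ℓ := by
  rw [deriv_gaussInvAcc]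
  have hs : 0 < sqrt 2 := by positivity
  have hp : 0 < sqrt π := by positivity
  have hs2 : sqrt 2 * sqrt 2 = 2 := Real.mul_self_sqrt (by norm_num)
  have hx : 0 < ℓ / (2 * sqrt 2) := by positivity
  have hG : ℓ / (2 * sqrt 2) * sqrt π < gaussInvAcc ℓ := by
    rw [gaussInvAcc_apply]
    have h := erfc_lt_inv_mul (ℓ / (2 * sqrt 2)) hx
    exact (lt_one_div (gaussAcc_pos ℓ) (by positivity)).1 h
  have hn0 : gaussNegLogDeriv 0 = 1 / (sqrt π * sqrt 2) := by
    rw [gaussNegLogDeriv_zero]; field_simp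
  have hn : gaussNegLogDeriv 0 ≤ gaussNegLogDeriv ℓ := strictMono_gaussNegLogDeriv.monotone hℓ.le
  have hn0pos : 0 < gaussNegLogDeriv 0 := gaussNegLogDeriv_pos 0
  have e : ℓ / 4 = (ℓ / (2 * sqrt 2) * sqrt π) * gaussNegLogDeriv 0 := by
    rw [hn0]
    field_simp
    nlinarith [hs2]
  rw [e]
  calc (ℓ / (2 * sqrt 2) * sqrt π) * gaussNegLogDeriv 0
      < gaussInvAcc ℓ * gaussNegLogDeriv 0 := mul_lt_mul_of_pos_right hG hn0pos
    _ ≤ gaussInvAcc ℓ * gaussNegLogDeriv ℓ := mul_le_mul_of_nonneg_left hn (gaussInvAcc_pos ℓ).le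

/-- **The critical gap at weight ratio `R`**: the least stiffness `c ≥ 0` at which `G′(c) ≥ R·G′(0)` (for
`R ≥ 1` the unique solution of `G′(c) = R·G′(0)`; `0` for `R ≤ 1`). [ours] -/
def critGap (R : ℝ) : ℝ := sInf {c : ℝ | 0 ≤ c ∧ R * deriv gaussInvAcc 0 ≤ deriv gaussInvAcc c}

/-- The defining set is nonempty (`G′` is unbounded). [ours] -/
theorem critGap_set_nonempty (R : ℝ) :
    {c : ℝ | 0 ≤ c ∧ R * deriv gaussInvAcc 0 ≤ deriv gaussInvAcc c}.Nonempty := by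
  rcases le_or_gt (R * deriv gaussInvAcc 0) 0 with h | h
  · exact ⟨0, le_rfl, h.trans (deriv_gaussInvAcc_pos 0).le⟩
  · refine ⟨4 * (R * deriv gaussInvAcc 0), by positivity, ?_⟩
    have h4 := div_four_lt_deriv_gaussInvAcc (show 0 < 4 * (R * deriv gaussInvAcc 0) by positivity)
    have e : 4 * (R * deriv gaussInvAcc 0) / 4 = R * deriv gaussInvAcc 0 := by ring
    rw [e] at h4
    exact h4.le

/-- The defining set is bounded below (by `0`). [ours] -/
theorem critGap_set_bddBelow (R : ℝ) :
    BddBelow {c : ℝ | 0 ≤ c ∧ R * deriv gaussInvAcc 0 ≤ deriv gaussInvAcc c} := ⟨0, fun _ hc => hc.1⟩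

/-- The defining set is closed (`G′` is continuous). [ours] -/
theorem critGap_set_isClosed (R : ℝ) :
    IsClosed {c : ℝ | 0 ≤ c ∧ R * deriv gaussInvAcc 0 ≤ deriv gaussInvAcc c} := by
  rw [Set.setOf_and]
  exact (isClosed_le continuous_const continuous_id).inter
    (isClosed_le continuous_const continuous_deriv_gaussInvAcc)

/-- `critGap R ≥ 0` and `G′(critGap R) ≥ R·G′(0)` (the infimum is attained). [ours] -/
theorem critGap_spec (R : ℝ) : 0 ≤ critGap R ∧ R * deriv gaussInvAcc 0 ≤ deriv gaussInvAcc (critGap R) :=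
  (critGap_set_isClosed R).csInf_mem (critGap_set_nonempty R) (critGap_set_bddBelow R)

/-- `critGap R ≥ 0`. [ours] -/
theorem critGap_nonneg (R : ℝ) : 0 ≤ critGap R := (critGap_spec R).1

/-- `R·G′(0) ≤ G′(critGap R)`. [ours] -/
theorem le_deriv_critGap (R : ℝ) : R * deriv gaussInvAcc 0 ≤ deriv gaussInvAcc (critGap R) := (critGap_spec R).2

/-- Minimality: any `c ≥ 0` with `G′(c) ≥ R·G′(0)` is `≥ critGap R`. [ours] -/
theorem critGap_le {R c : ℝ} (hc : 0 ≤ c) (h : R * deriv gaussInvAcc 0 ≤ deriv gaussInvAcc c) : critGap R ≤ c :=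
  csInf_le (critGap_set_bddBelow R) ⟨hc, h⟩

/-- `critGap R = 0` for `R ≤ 1`. [ours] -/
theorem critGap_of_le_one {R : ℝ} (hR : R ≤ 1) : critGap R = 0 :=
  le_antisymm (critGap_le le_rfl (mul_le_of_le_one_left (deriv_gaussInvAcc_pos 0).le hR)) (critGap_nonneg R)

/-- **`G′(critGap R) = R·G′(0)` for `R ≥ 1`** (intermediate value theorem on `[0, critGap R]`). [ours] -/
theorem deriv_critGap_eq {R : ℝ} (hR : 1 ≤ R) : deriv gaussInvAcc (critGap R) = R * deriv gaussInvAcc 0 := by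
  refine le_antisymm ?_ (le_deriv_critGap R)
  have h0 : deriv gaussInvAcc 0 ≤ R * deriv gaussInvAcc 0 :=
    le_mul_of_one_le_left (deriv_gaussInvAcc_pos 0).le hR
  have hmem : R * deriv gaussInvAcc 0 ∈ Set.Icc (deriv gaussInvAcc 0) (deriv gaussInvAcc (critGap R)) :=
    ⟨h0, le_deriv_critGap R⟩
  obtain ⟨c, hc, hcv⟩ :=
    intermediate_value_Icc (critGap_nonneg R) continuous_deriv_gaussInvAcc.continuousOn hmem
  have hle : critGap R ≤ c := critGap_le hc.1 hcv.ge
  have e : c = critGap R := le_antisymm hc.2 hle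
  rw [← e, hcv]

/-- **CHARACTERISATION** (`R ≥ 1`, any real `c`): `G′(c) ≤ R·G′(0) ↔ c ≤ critGap R`. [ours] -/
theorem deriv_le_iff_le_critGap {R : ℝ} (hR : 1 ≤ R) (c : ℝ) :
    deriv gaussInvAcc c ≤ R * deriv gaussInvAcc 0 ↔ c ≤ critGap R := by
  constructor
  · intro h
    by_contra hlt
    rw [not_le] at hlt
    have h' := strictMono_deriv_gaussInvAcc hlt
    rw [deriv_critGap_eq hR] at h'
    linarith
  · intro h
    calc deriv gaussInvAcc c ≤ deriv gaussInvAcc (critGap R) := strictMono_deriv_gaussInvAcc.monotone h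
      _ = R * deriv gaussInvAcc 0 := deriv_critGap_eq hR

/-- Equivalently (`R ≥ 1`): `R·G′(0) < G′(c) ↔ critGap R < c`. [ours] -/
theorem lt_deriv_iff_critGap_lt {R : ℝ} (hR : 1 ≤ R) (c : ℝ) :
    R * deriv gaussInvAcc 0 < deriv gaussInvAcc c ↔ critGap R < c := by
  rw [← not_le, deriv_le_iff_le_critGap hR c, not_le]

/-- `critGap R > 0` for `R > 1`. [ours] -/
theorem critGap_pos {R : ℝ} (hR : 1 < R) : 0 < critGap R := by
  by_contra h
  rw [not_lt] at h
  have h0 : critGap R = 0 := le_antisymm h (critGap_nonneg R)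
  have h1 := le_deriv_critGap R
  rw [h0] at h1
  have hd := deriv_gaussInvAcc_pos 0
  nlinarith

/-- `critGap` is monotone in the ratio. [ours] -/
theorem critGap_mono {R R' : ℝ} (h : R ≤ R') : critGap R ≤ critGap R' :=
  critGap_le (critGap_nonneg R')
    ((mul_le_mul_of_nonneg_right h (deriv_gaussInvAcc_pos 0).le).trans (le_deriv_critGap R'))

/-- A crude explicit ceiling: `critGap R < 4R·G′(0)` for `R > 1` (from `G′(c) > c/4`). [ours] -/
theorem critGap_lt_linear {R : ℝ} (hR : 1 < R) : critGap R < 4 * R * deriv gaussInvAcc 0 := by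
  have h := div_four_lt_deriv_gaussInvAcc (critGap_pos hR)
  rw [deriv_critGap_eq hR.le] at h
  linarith

end CritGap

/-! ## §2 The largest passage weight and the critical stiffness `Λ_c(K)` -/

section Threshold

variable {K j : ℕ}

/-- The largest passage weight `w_max = w_{⌊(K−1)/2⌋}` (`= ⌊(K+1)/2⌋·⌈(K+1)/2⌉`). [ours] -/
def maxPassageWeight (K : ℕ) : ℝ := passageWeight K ((K - 1) / 2)

/-- `maxPassageWeight K = passageWeight K ((K−1)/2)`. [ours] -/
theorem maxPassageWeight_eq (K : ℕ) : maxPassageWeight K = passageWeight K ((K - 1) / 2) := rfl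

/-- The middle index is `< K` (`K ≥ 1`). [ours] -/
theorem middle_lt (hK : 0 < K) : (K - 1) / 2 < K := by omega

/-- **`w_j ≤ w_max` for every `j < K`**: `(m+1)(K−m) − (j+1)(K−j) = (m−j)(K−1−m−j) ≥ 0` for `m = ⌊(K−1)/2⌋`. [ours] -/
theorem passageWeight_le_max (hj : j < K) : passageWeight K j ≤ maxPassageWeight K := by
  unfold maxPassageWeight passageWeight
  set m := (K - 1) / 2 with hm
  have h1 : 2 * m + 1 ≤ K := by omega
  have h2 : K ≤ 2 * m + 2 := by omega
  have h1' : (2 : ℝ) * m + 1 ≤ K := by exact_mod_cast h1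
  have h2' : (K : ℝ) ≤ 2 * m + 2 := by exact_mod_cast h2
  rcases le_or_gt j m with hjm | hjm
  · have hjm' : (j : ℝ) ≤ m := by exact_mod_cast hjm
    have ha : (0 : ℝ) ≤ (m : ℝ) - j := by linarith
    have hb : (0 : ℝ) ≤ (K : ℝ) - 1 - m - j := by linarith
    nlinarith [mul_nonneg ha hb]
  · have hjm' : (m : ℝ) + 1 ≤ j := by exact_mod_cast hjm
    have ha : (0 : ℝ) ≤ (j : ℝ) - m := by linarith
    have hb : (0 : ℝ) ≤ (m : ℝ) + j + 1 - K := by linarith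
    nlinarith [mul_nonneg ha hb]

/-- `w_max > 0` (`K ≥ 1`). [ours] -/
theorem maxPassageWeight_pos (hK : 0 < K) : 0 < maxPassageWeight K := passageWeight_pos (middle_lt hK)

/-- `1 ≤ (w_max/w_j)²` for `j < K`. [ours] -/
theorem one_le_weightRatio_sq (hj : j < K) : 1 ≤ (maxPassageWeight K / passageWeight K j) ^ 2 := by
  have hw := passageWeight_pos hj
  have h1 : 1 ≤ maxPassageWeight K / passageWeight K j := by
    rw [le_div_iff₀ hw, one_mul]; exact passageWeight_le_max hj
  exact one_le_pow₀ h1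

/-- **The critical total stiffness `Λ_c(K) = Σ_{j<K} critGap((w_max/w_j)²)`.** [ours] -/
def thresholdStiffness (K : ℕ) : ℝ := ∑ j ∈ range K, critGap ((maxPassageWeight K / passageWeight K j) ^ 2)

/-- `Λ_c(K) ≥ 0`. [ours] -/
theorem thresholdStiffness_nonneg (K : ℕ) : 0 ≤ thresholdStiffness K :=
  sum_nonneg fun _ _ => critGap_nonneg _

/-- **`Λ_c(K) = 0` for `K ≤ 2`** (all passage weights are equal). [ours] -/
theorem thresholdStiffness_of_le_two (hK : K ≤ 2) : thresholdStiffness K = 0 := by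
  unfold thresholdStiffness
  refine sum_eq_zero fun j hj => critGap_of_le_one ?_
  have hjK := mem_range.1 hj
  interval_cases K <;> interval_cases j <;> norm_num [maxPassageWeight, passageWeight]

/-- **`Λ_c(K) > 0` for `K ≥ 3`** (`w_0 = K < w_1 = 2(K−1) ≤ w_max`). [ours] -/
theorem thresholdStiffness_pos (hK : 3 ≤ K) : 0 < thresholdStiffness K := by
  unfold thresholdStiffness
  refine sum_pos' (fun _ _ => critGap_nonneg _) ⟨0, mem_range.2 (by omega), critGap_pos ?_⟩
  have h1 : passageWeight K 1 ≤ maxPassageWeight K := passageWeight_le_max (by omega)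
  have hlt : passageWeight K 0 < passageWeight K 1 := passageWeight_zero_lt one_pos (by omega)
  have h0 : (0 : ℝ) < passageWeight K 0 := passageWeight_pos (by omega)
  have hgt : 1 < maxPassageWeight K / passageWeight K 0 := by
    rw [lt_div_iff₀ h0, one_mul]; linarith
  exact one_lt_pow₀ hgt two_ne_zero

/-- Structural ceiling: `Λ_c(K) ≤ K·critGap((w_max/K)²)` (`w_j ≥ w_0 = K` — `SwapLadderIndexTauIntTuning.le_passageWeight`,
re-derived inline since that module is not imported — and `critGap` is monotone). [ours] -/
theorem thresholdStiffness_le (hK : 0 < K) :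
    thresholdStiffness K ≤ K * critGap ((maxPassageWeight K / K) ^ 2) := by
  unfold thresholdStiffness
  have hK' : (0 : ℝ) < K := by exact_mod_cast hK
  have key : ∀ j ∈ range K, critGap ((maxPassageWeight K / passageWeight K j) ^ 2)
      ≤ critGap ((maxPassageWeight K / K) ^ 2) := by
    intro j hj
    have hjK := mem_range.1 hj
    have hKw : (K : ℝ) ≤ passageWeight K j := by
      unfold passageWeight
      have h1 : (j : ℝ) + 1 ≤ K := by exact_mod_cast hjK
      have hj0 : (0 : ℝ) ≤ j := Nat.cast_nonneg j
      nlinarith [mul_nonneg hj0 (sub_nonneg.2 h1)]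
    refine critGap_mono (pow_le_pow_left₀
      (div_nonneg (maxPassageWeight_pos hK).le (passageWeight_pos hjK).le) ?_ 2)
    exact div_le_div_of_nonneg_left (maxPassageWeight_pos hK).le hK' hKw
  calc ∑ j ∈ range K, critGap ((maxPassageWeight K / passageWeight K j) ^ 2)
      ≤ ∑ j ∈ range K, critGap ((maxPassageWeight K / K) ^ 2) := sum_le_sum key
    _ = K * critGap ((maxPassageWeight K / K) ^ 2) := by rw [sum_const, card_range, nsmul_eq_mul]

/-- Structural floor: `2·critGap((w_max/K)²) ≤ Λ_c(K)` for `K ≥ 2` (the two end pairs, `w_0 = w_{K−1} = K`). [ours] -/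
theorem two_mul_critGap_le_thresholdStiffness (hK : 2 ≤ K) :
    2 * critGap ((maxPassageWeight K / K) ^ 2) ≤ thresholdStiffness K := by
  unfold thresholdStiffness
  have h0 : passageWeight K 0 = K := by simp [passageWeight]
  have h1 : passageWeight K (K - 1) = K := by
    have := passageWeight_symm (K := K) (j := 0) (by omega)
    rw [Nat.sub_zero] at this
    rw [this, h0]
  have hsub : ({0, K - 1} : Finset ℕ) ⊆ range K := by
    intro x hx
    simp only [mem_insert, mem_singleton] at hx
    rcases hx with rfl | rfl <;> simp <;> omega
  have hle := sum_le_sum_of_subset_of_nonneg hsub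
    (f := fun j => critGap ((maxPassageWeight K / passageWeight K j) ^ 2)) (fun _ _ _ => critGap_nonneg _)
  rw [sum_pair (show (0 : ℕ) ≠ K - 1 by omega), h0, h1] at hle
  linarith

end Threshold

end Summit.Ventures.LatticeQCDFlow.Scaling

end
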